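import Literature.AlgebraicGeometry.Resolution.JacobianRegularLocus
import Summits.ResolutionOfSingularities.ResolutionOfSingularities.Theorems.FrobeniusLadderFInjectiveMacaulayficationQuotLocalizationIso
import Mathlib.RingTheory.RegularLocalRing.Polynomial
import Mathlib.RingTheory.Ideal.KrullsHeightTheorem
import Mathlib.Algebra.MvPolynomial.PDeriv
import HarnessLib

/-!
# The Jacobian criterion for a hypersurface, regular direction, at an arbitrary prime

Support file for crux stmt-ResolutionOfSingularities-15315 (`FrobeniusLadder.FInjectiveMacaulayfication`,
line `Sketch`, lead seat c4, cycle 5, wave 2): stub `stub_hypersurfaceRegularOfPderiv` of the §7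
CALIBRATION package (the blow-up `Bl_𝔪 E₈⁰` in characteristic `5`, certified through the blow-up glue
E6′). In the line the chart rings of the blow-up are hypersurface rings `k[X₀, …, X_{n-1}]/(g)` (strict
transform presentation), and this file certifies that such a ring is regular at every prime `Q` at which
some partial derivative `∂g/∂Xᵢ` does not vanish, i.e. `∂g/∂Xᵢ ∉ P` for the prime `P = Q ∩ k[X]` of
`S = k[X]` above `Q` — the regular direction of the Jacobian criterion at an ARBITRARY prime (not only at
rational closed points).

What is proved (`S = k[X₀, …, X_{n-1}]`, `k` a field):

* `height_map_span_singleton_eq_one` — for a Noetherian domain `S`, a prime `P` and `0 ≠ g ∈ P`, the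
  extended ideal `(g)S_P` has height exactly `1`: it is principal, generated by the non-zero-divisor
  `g/1` of the domain `S_P` (`S → S_P` is injective) which is a non-unit (`g ∈ P`), so Krull's
  principal ideal theorem in the form `Ideal.height_span_singleton_eq_one_of_mem_nonZeroDivisors` applies.
* `isRegularLocalRing_localization_quotient_of_pderiv_not_mem` — if `g ∈ P` and `∂g/∂Xᵢ ∉ P` then
  `S_P/(g)S_P` is a regular local ring: Matsumura's Thm. 30.4 (ii) (tree theorem
  `Literature.AlgebraicGeometry.Resolution.Matsumura1987_30_4_ii`) with `R = S`, `r = 1`, `I = (g)`,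
  `D₁ = ∂/∂Xᵢ` (as a `ℤ`-derivation), `f₁ = g`: `S_P` is regular (a polynomial ring over a field is a
  regular ring, Mathlib instances), `ht (g)S_P = 1` (previous bullet; `g ≠ 0` because `∂0/∂Xᵢ = 0 ∈ P`),
  and the `1 × 1` Jacobian determinant is `∂g/∂Xᵢ ∉ P`.
* `stub_hypersurfaceRegularOfPderiv` — the registered form: for a prime `Q` of `S/(g)` with
  `∂g/∂Xᵢ ∉ P := Q.comap mk`, the local ring `(S/(g))_Q` is regular. Indeed `g ∈ P` (`ḡ = 0 ∈ Q`), so the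
  previous bullet gives regularity of `S_P/(g/1)`, which is isomorphic to `(S/(g))_Q` by the E6 glue
  isomorphism `stub_quotLocalizationIso` (localization commutes with the quotient by `(g)`), and
  regularity is transported along ring isomorphisms (`IsRegularLocalRing.of_ringEquiv`).

References: H. Matsumura, *Commutative Ring Theory*, Cambridge Stud. Adv. Math. 8, CUP 1986,
Thm. 30.4 (ii), p. 233 [Matsumura1987]; for context, the classical Jacobian criterion at closed points,
R. Hartshorne, *Algebraic Geometry*, GTM 52, Ch. I, Thm. 5.1.
-/

-- single-problem summit: the doubled namespace component is forced
set_option linter.dupNamespace false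

noncomputable section

namespace Summit.ResolutionOfSingularities.ResolutionOfSingularities.Theorems.FInjectiveMacaulayfication.HypersurfaceRegular

open IsLocalRing

/-- **A non-zero principal ideal of a Noetherian domain, extended to `S_P` for a prime `P ∋ g`, has
height one**: `ht (g)S_P = 1` for `0 ≠ g ∈ P`. The extension is the principal ideal `(g/1)`
(`Ideal.map_span`); `g/1 ≠ 0` since `S → S_P` is injective for a domain, and `g/1` is not a unit since
it lies in the maximal ideal `PS_P`; conclude by Krull's principal ideal theorem
(`Ideal.height_span_singleton_eq_one_of_mem_nonZeroDivisors`). [folklore] -/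
theorem height_map_span_singleton_eq_one {S : Type*} [CommRing S] [IsDomain S] [IsNoetherianRing S]
    (P : Ideal S) [P.IsPrime] {g : S} (hg0 : g ≠ 0) (hgP : g ∈ P) :
    ((Ideal.span {g}).map (algebraMap S (Localization.AtPrime P))).height = 1 := by
  rw [Ideal.map_span, Set.image_singleton]
  refine Ideal.height_span_singleton_eq_one_of_mem_nonZeroDivisors ?_ ?_
  · refine mem_nonZeroDivisors_of_ne_zero fun h => hg0 ?_
    exact (IsLocalization.to_map_eq_zero_iff (Localization.AtPrime P)
      P.primeCompl_le_nonZeroDivisors).mp h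
  · exact (mem_maximalIdeal _).mp
      ((IsLocalization.AtPrime.to_map_mem_maximal_iff (Localization.AtPrime P) P g).mpr hgP)

/-- **Jacobian criterion for a hypersurface, regular direction, inside `S = k[X₀, …, X_{n-1}]`**: if
`g ∈ P` and `∂g/∂Xᵢ ∉ P` for a prime `P` of `S`, then `S_P/(g/1)` is a regular local ring. This is
Matsumura's Thm. 30.4 (ii) with `R = S`, `r = 1`, `I = (g)`, `D₁ = ∂/∂Xᵢ`, `f₁ = g`: `S_P` is regular
(polynomial rings over a field are regular), `ht (g)S_P = 1` (`height_map_span_singleton_eq_one`, with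
`g ≠ 0` because `∂0/∂Xᵢ = 0 ∈ P`), and `det (D₁ f₁) = ∂g/∂Xᵢ ∉ P`.
[cite: Matsumura1987, Thm. 30.4 (ii)] -/
theorem isRegularLocalRing_localization_quotient_of_pderiv_not_mem (k : Type) [Field k] (n : ℕ)
    (g : MvPolynomial (Fin n) k) (i : Fin n) (P : Ideal (MvPolynomial (Fin n) k)) [P.IsPrime]
    (hgP : g ∈ P) (hd : MvPolynomial.pderiv i g ∉ P) :
    IsRegularLocalRing (Localization.AtPrime P ⧸
      Ideal.span {algebraMap (MvPolynomial (Fin n) k) (Localization.AtPrime P) g}) := by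
  have hg0 : g ≠ 0 := by
    rintro rfl
    exact hd (by rw [map_zero]; exact P.zero_mem)
  have hreg : IsRegularLocalRing (Localization.AtPrime P) := inferInstance
  have hht : ((Ideal.span {g}).map (algebraMap (MvPolynomial (Fin n) k)
      (Localization.AtPrime P))).height = (1 : ℕ) := by
    rw [Nat.cast_one]
    exact height_map_span_singleton_eq_one P hg0 hgP
  have h := (Literature.AlgebraicGeometry.Resolution.Matsumura1987_30_4_ii P hreg (Ideal.span {g})
    hht (fun _ => (MvPolynomial.pderiv i).restrictScalars ℤ) (fun _ => g)
    (fun _ => Ideal.mem_span_singleton_self g) ((Ideal.span_singleton_le_iff_mem P).mpr hgP)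
    (by simpa only [Matrix.det_fin_one, Matrix.of_apply, Derivation.restrictScalars_apply] using hd)).2
  rwa [Ideal.map_span, Set.image_singleton] at h

/-- **Jacobian criterion for a hypersurface, regular direction, at an arbitrary prime** (registered
stub `stub_hypersurfaceRegularOfPderiv` of the §7 calibration package): for a field `k`,
`g ∈ S = k[X₀, …, X_{n-1}]` and a prime `Q` of `S/(g)`, if `∂g/∂Xᵢ ∉ P = Q ∩ S` for some `i`, then
`(S/(g))_Q` is a regular local ring. Proof: `g ∈ P` (its class is `0 ∈ Q`), so `S_P/(g/1)` is regular
(`isRegularLocalRing_localization_quotient_of_pderiv_not_mem`, Matsumura Thm. 30.4 (ii)), and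
`S_P/(g/1) ≅ (S/(g))_Q` (localization commutes with quotients, `stub_quotLocalizationIso`); regularity
passes along ring isomorphisms. [cite: Matsumura1987, Thm. 30.4 (ii)] -/
theorem stub_hypersurfaceRegularOfPderiv : ∀ (k : Type) [Field k] (n : ℕ) (g : MvPolynomial (Fin n) k)
    (i : Fin n) (Q : Ideal (MvPolynomial (Fin n) k ⧸ Ideal.span {g})) [Q.IsPrime],
    MvPolynomial.pderiv i g ∉ Q.comap (Ideal.Quotient.mk (Ideal.span {g})) →
      IsRegularLocalRing (Localization.AtPrime Q) := by
  intro k _ n g i Q _ hd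
  have hgP : g ∈ Q.comap (Ideal.Quotient.mk (Ideal.span {g})) := by
    rw [Ideal.mem_comap, Ideal.Quotient.eq_zero_iff_mem.mpr (Ideal.mem_span_singleton_self g)]
    exact Q.zero_mem
  haveI := isRegularLocalRing_localization_quotient_of_pderiv_not_mem k n g i
    (Q.comap (Ideal.Quotient.mk (Ideal.span {g}))) hgP hd
  obtain ⟨e⟩ := QuotLocalizationIso.stub_quotLocalizationIso (MvPolynomial (Fin n) k) g
    (Q.comap (Ideal.Quotient.mk (Ideal.span {g}))) Q rfl
  exact IsRegularLocalRing.of_ringEquiv e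

end Summit.ResolutionOfSingularities.ResolutionOfSingularities.Theorems.FInjectiveMacaulayfication.HypersurfaceRegular

end
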